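import Summits.AtomisticToContinuum.Crystallization.Theorems.OverbindingBudgetCorefreeBridge
import Summits.AtomisticToContinuum.Crystallization.Theorems.PhononStability.Negative.Mirror

/-!
# `OverbindingBudget` / crux `RobustDefectLimitWindows` — the piece `MuGSCForceBalance`, PROVED

Route `OverbindingBudget` (sub-problem `Crystallization`), crux `RobustDefectLimitWindows`
(item `stmt-AtomisticToContinuum-31280`), skeleton «HostedDustCut» (v7), door half B
`stub_corefreeRigidity`, helper-level sub-line `CorefreeRigidity` (lineage `decomp-a2c-lens-4`, g16).
This file CLOSES the piece `MuGSCForceBalance` of `Theorems.OverbindingBudgetCorefreeBridge`: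

> every uniformly discrete μ-grand-canonical Lennard-Jones ground state `Y ⊆ ℝ³` is force balanced —
> for every `p ∈ Y`, `Σ_{q ∈ Y, q ≠ p} (V′(|p − q|)/|p − q|)(p − q) = 0` as a `HasSum`
> (verbatim the `Equil` hypothesis of `ExcessDecayLiouville.HcpLiouville`).

Proof (Fermat, as in the finite item `ExcessDecayLiouville.ForceBalance`, 9335): moving the single
particle `p` to a point `w` with `|w − p| < δ/2` (`δ` the separation of `Y`) is an admissible finite
modification (`IsMuGSC.exchange` with `X_f = {p}`, `R = {w}`), so `p` is a local minimiser of the field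
`Φ(w) = Σ_{q ∈ Y ∖ {p}} V(|w − q|)`; `Φ` is differentiable at `p` with derivative the series of the
pair-force functionals (`hasFDerivAt_tsum_of_isPreconnected` on the ball `B(p, δ/2)`, the derivative of
each term being bounded there by `(2/|p − q|)¹³ + (2/|p − q|)⁷`, a field with an `r⁻⁶` tail, summable over
the uniformly discrete `Y` by shell counting, `UniformlyDiscrete.summable_of_abs_le_inv_pow_six`);
Fermat gives derivative `0`, and testing the vanishing functional series against every vector gives the
vector identity.  After this file the sub-line `CorefreeRigidity` has three open pieces
(`CorefreeChart`, `LargeScaleRegularity`, `StackingSelection`).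
-/

noncomputable section

namespace Summit.AtomisticToContinuum.Crystallization.Theorems.OverbindingBudgetCorefreeBridge

open Literature.MathematicalPhysics.StatisticalMechanics (UniformlyDiscrete lennardJones IsMuGSC
  fieldEnergy interactionEnergy interactionEnergy_of_subsingleton)
open Summit.AtomisticToContinuum.Crystallization.Theorems.PhononStabilityNegative
  (hasDerivAt_lennardJones deriv_lennardJones)
open scoped RealInnerProductSpace
open Filter Topology Metric

/-! ### Calculus of the pair terms
(the two lemmas below repeat `Theorems.ExcessDecayLiouvilleForceBalance`'s, specialised to `ℝ³`;
`V′_LJ` comes from `Theorems.PhononStability.Negative.Mirror`) -/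

/-- `D|w − q|(p) = |p − q|⁻¹ ⟨p − q, ·⟩` at `p ≠ q`. [folklore] -/
theorem hasFDerivAt_dist_left {p q : E3} (hpq : p ≠ q) :
    HasFDerivAt (fun w : E3 => dist w q) ((dist p q)⁻¹ • innerSL ℝ (p - q)) p := by
  have hne : ‖p - q‖ ≠ 0 := norm_ne_zero_iff.2 (sub_ne_zero.2 hpq)
  have hsq : ‖p - q‖ ^ 2 ≠ 0 := pow_ne_zero 2 hne
  have h1 := ((hasFDerivAt_sub_const (x := p) q).norm_sq).sqrt hsq
  have hfun : (fun w : E3 => √(‖w - q‖ ^ 2)) = fun w => dist w q :=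
    funext fun w => by rw [Real.sqrt_sq (norm_nonneg _), dist_eq_norm]
  have key : (1 / (2 * √(‖p - q‖ ^ 2))) •
      ((2 • innerSL ℝ (p - q)).comp (ContinuousLinearMap.id ℝ E3)) =
      (dist p q)⁻¹ • innerSL ℝ (p - q) := by
    ext z
    simp only [Real.sqrt_sq (norm_nonneg _), dist_eq_norm, smul_apply,
      ContinuousLinearMap.comp_apply, ContinuousLinearMap.id_apply, smul_eq_mul, nsmul_eq_mul,
      Nat.cast_ofNat]
    field_simp
  rw [hfun] at h1
  rw [← key]
  exact h1

/-- Chain rule: `D[V(|w − q|)](p) = (V′(d)/d) ⟨p − q, ·⟩`, `d = |p − q| > 0`. [folklore] -/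
theorem hasFDerivAt_comp_dist_left {V : ℝ → ℝ} {V' : ℝ} {p q : E3} (hpq : p ≠ q)
    (hV : HasDerivAt V V' (dist p q)) :
    HasFDerivAt (fun w : E3 => V (dist w q)) ((V' / dist p q) • innerSL ℝ (p - q)) p := by
  have h := hV.comp_hasFDerivAt p (hasFDerivAt_dist_left hpq)
  rw [smul_smul, ← div_eq_mul_inv] at h
  exact h

/-! ### The uniform derivative bound near a site -/

/-- The majorant `U(t) = (2/t)¹³ + (2/t)⁷` of `|V′|` on the ball of radius `t/2` about a point at
distance `t`. -/
def derivBound (t : ℝ) : ℝ := (2 * t⁻¹) ^ 13 + (2 * t⁻¹) ^ 7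

/-- `U` has an `r⁻⁶` tail: `|U(t)| ≤ (2¹³ δ⁻⁷ + 2⁷ δ⁻¹) t⁻⁶` for `t ≥ δ > 0`. [folklore] -/
theorem abs_derivBound_le {δ t : ℝ} (hδ : 0 < δ) (ht : δ ≤ t) :
    |derivBound t| ≤ (2 ^ 13 * δ⁻¹ ^ 7 + 2 ^ 7 * δ⁻¹) * t⁻¹ ^ 6 := by
  have ht0 : 0 < t := hδ.trans_le ht
  have hi0 : 0 ≤ t⁻¹ := inv_nonneg.2 ht0.le
  have hi : t⁻¹ ≤ δ⁻¹ := (inv_le_inv₀ ht0 hδ).2 ht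
  have h7 : t⁻¹ ^ 7 ≤ δ⁻¹ ^ 7 := pow_le_pow_left₀ hi0 hi 7
  unfold derivBound
  rw [abs_of_nonneg (by positivity)]
  calc (2 * t⁻¹) ^ 13 + (2 * t⁻¹) ^ 7 = (2 ^ 13 * t⁻¹ ^ 7) * t⁻¹ ^ 6 + (2 ^ 7 * t⁻¹) * t⁻¹ ^ 6 := by
        ring
    _ ≤ (2 ^ 13 * δ⁻¹ ^ 7) * t⁻¹ ^ 6 + (2 ^ 7 * δ⁻¹) * t⁻¹ ^ 6 := by gcongr
    _ = (2 ^ 13 * δ⁻¹ ^ 7 + 2 ^ 7 * δ⁻¹) * t⁻¹ ^ 6 := by ring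

/-- Near a site: if `|p − y| ≥ δ` and `|w − p| < δ/2` then `|w − y| > 0` and
`|V′(|w − y|)| ≤ U(|p − y|)`. [folklore] -/
theorem abs_deriv_le_derivBound {p w y : E3} {δ : ℝ} (hy : δ ≤ dist p y)
    (hw : dist w p < δ / 2) : 0 < dist w y ∧ |deriv lennardJones (dist w y)| ≤ derivBound (dist p y) := by
  have htri : dist p y ≤ dist p w + dist w y := dist_triangle p w y
  have hpw : dist p w < δ / 2 := by rwa [dist_comm] at hw
  have hd : dist p y / 2 ≤ dist w y := by linarith
  have hD : 0 < dist p y := by linarith [dist_nonneg (x := p) (y := w)]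
  have hd0 : 0 < dist w y := by linarith
  refine ⟨hd0, ?_⟩
  rw [deriv_lennardJones hd0.ne']
  have hi : (dist w y)⁻¹ ≤ 2 * (dist p y)⁻¹ := by
    have h := (inv_le_inv₀ hd0 (by positivity : 0 < dist p y / 2)).2 hd
    rwa [inv_div, div_eq_mul_inv] at h
  have hi0 : 0 ≤ (dist w y)⁻¹ := inv_nonneg.2 hd0.le
  calc |-(dist w y)⁻¹ ^ 13 + (dist w y)⁻¹ ^ 7| ≤ (dist w y)⁻¹ ^ 13 + (dist w y)⁻¹ ^ 7 := by
        refine abs_le.2 ⟨?_, ?_⟩ <;> nlinarith [pow_nonneg hi0 13, pow_nonneg hi0 7]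
    _ ≤ (2 * (dist p y)⁻¹) ^ 13 + (2 * (dist p y)⁻¹) ^ 7 := by gcongr
    _ = derivBound (dist p y) := rfl

/-- The operator norm of the pair-force functional `(c/|w − y|)⟨w − y, ·⟩` is `|c|`. [folklore] -/
theorem norm_force_functional {w y : E3} (h : 0 < dist w y) (c : ℝ) :
    ‖(c / dist w y) • innerSL ℝ (w - y)‖ = |c| := by
  rw [norm_smul, innerSL_apply_norm, ← dist_eq_norm, Real.norm_eq_abs, abs_div, abs_of_pos h,
    div_mul_cancel₀ _ h.ne']

/-- The norm of the pair force `(c/|w − y|)(w − y)` is `|c|`. [folklore] -/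
theorem norm_force_vector {w y : E3} (h : 0 < dist w y) (c : ℝ) :
    ‖(c / dist w y) • (w - y)‖ = |c| := by
  rw [norm_smul, ← dist_eq_norm, Real.norm_eq_abs, abs_div, abs_of_pos h, div_mul_cancel₀ _ h.ne']

/-! ### Index bookkeeping -/

/-- The index type `{q // q ∈ Y ∧ q ≠ p}` of `Equil` is the coercion of the set `Y ∖ {p}` that
`IsMuGSC` produces for the removal `X_f = {p}`. [folklore] -/
def idxEquiv (Y : Set E3) (p : E3) : {q : E3 // q ∈ Y ∧ q ≠ p} ≃ ↥(Y \ {p}) :=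
  Equiv.subtypeEquivRight fun q => by simp

/-- The inclusion of the index type into `Y`. -/
def inclIdx (Y : Set E3) (p : E3) : {q : E3 // q ∈ Y ∧ q ≠ p} → ↥Y := fun q => ⟨q.1, q.2.1⟩

/-- The inclusion is injective. [folklore] -/
theorem inclIdx_injective (Y : Set E3) (p : E3) : Function.Injective (inclIdx Y p) := by
  intro a b h
  apply Subtype.ext
  have h' := congrArg Subtype.val h
  exact h'

/-- Restricting a summable field over `Y` to the indices `q ≠ p`. [folklore] -/
theorem summable_restrict {Y : Set E3} {p : E3} {g : E3 → ℝ} (h : Summable fun y : ↥Y => g y) :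
    Summable fun q : {q : E3 // q ∈ Y ∧ q ≠ p} => g q.1 :=
  (h.comp_injective (inclIdx_injective Y p)).congr fun _ => rfl

/-! ### Local minimality of a site in its own field -/

/-- **One-particle moves are admissible.** For a uniformly `δ`-separated μ-ground state `Y ∋ p`, the
site `p` is a local minimiser of the field `w ↦ Σ_{q ∈ Y, q ≠ p} V(|w − q|)`: every `w` with
`|w − p| < δ/2` lies off `Y ∖ {p}`, so `X_f = {p} ↦ R = {w}` is a finite modification and
`IsMuGSC.exchange` applies. [folklore] -/
theorem isLocalMin_field {e : ℝ} {Y : Set E3} {δ : ℝ} (hδ : 0 < δ)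
    (hsep : ∀ x ∈ Y, ∀ y ∈ Y, x ≠ y → δ ≤ dist x y) (hμ : IsMuGSC lennardJones e Y) {p : E3}
    (hp : p ∈ Y) :
    IsLocalMin (fun w : E3 => ∑' q : {q : E3 // q ∈ Y ∧ q ≠ p}, lennardJones (dist w q.1)) p := by
  have hball : ball p (δ / 2) ∈ 𝓝 p := ball_mem_nhds p (half_pos hδ)
  filter_upwards [hball] with w hw
  have hwp : dist w p < δ / 2 := mem_ball.1 hw
  -- the one-point configurations
  have hxf : Function.Injective (fun _ : Fin 1 => p) := fun i j _ => Subsingleton.elim i j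
  have hR : Function.Injective (fun _ : Fin 1 => w) := fun i j _ => Subsingleton.elim i j
  have hrange_p : Set.range (fun _ : Fin 1 => p) = {p} := Set.range_const
  have hrange_w : Set.range (fun _ : Fin 1 => w) = {w} := Set.range_const
  have hX : Set.range (fun _ : Fin 1 => p) ⊆ Y := by
    rw [hrange_p]; exact Set.singleton_subset_iff.2 hp
  have hdisj : Disjoint (Set.range fun _ : Fin 1 => w) (Y \ Set.range fun _ : Fin 1 => p) := by
    rw [hrange_w, hrange_p, Set.disjoint_singleton_left]
    rintro ⟨hwY, hwp'⟩
    have hne : p ≠ w := fun h => hwp' (by rw [← h]; exact Set.mem_singleton p)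
    have hfar : δ ≤ dist p w := hsep p hp w hwY hne
    rw [dist_comm] at hfar
    linarith
  have hex := hμ.exchange hxf hX hR hdisj
  rw [interactionEnergy_of_subsingleton, interactionEnergy_of_subsingleton, zero_add, zero_add,
    hrange_p] at hex
  simp only [fieldEnergy, Fin.sum_univ_one] at hex
  -- transport the two series from the index set `Y ∖ {p}` to the index type `{q // q ∈ Y ∧ q ≠ p}`
  have hA := Equiv.tsum_eq (idxEquiv Y p) (fun y : ↥(Y \ {p}) => lennardJones (dist p (y : E3)))
  have hB := Equiv.tsum_eq (idxEquiv Y p) (fun y : ↥(Y \ {p}) => lennardJones (dist w (y : E3)))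
  simp only [idxEquiv, Equiv.subtypeEquivRight_apply_coe] at hA hB
  rw [← hA, ← hB] at hex
  exact hex

/-! ### The theorem -/

/-- **`MuGSCForceBalance` holds**: a uniformly discrete μ-grand-canonical Lennard-Jones ground state is
force balanced at every site, in the `HasSum` form of `ExcessDecayLiouville.HcpLiouville`. [folklore] -/
theorem muGSCForceBalance : MuGSCForceBalance := by
  intro e Y hUD hμ p hp
  classical
  obtain ⟨δ, hδ, hsep⟩ := id hUD
  -- every other site is `≥ δ` from `p`
  have hfar : ∀ q : {q : E3 // q ∈ Y ∧ q ≠ p}, δ ≤ dist p q.1 :=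
    fun q => hsep p hp q.1 q.2.1 (Ne.symm q.2.2)
  -- the summable majorant (an `r⁻⁶`-tailed field over the uniformly discrete `Y`)
  have h1 : Summable fun y : ↥Y => derivBound (dist p (y : E3)) :=
    hUD.summable_of_abs_le_inv_pow_six (C := 2 ^ 13 * δ⁻¹ ^ 7 + 2 ^ 7 * δ⁻¹) hδ
      (fun t ht => abs_derivBound_le hδ ht) p
  have hu : Summable fun q : {q : E3 // q ∈ Y ∧ q ≠ p} => derivBound (dist p q.1) :=
    summable_restrict (g := fun y => derivBound (dist p y)) h1
  -- termwise derivatives on the ball `B(p, δ/2)` and their bound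
  have hf : ∀ (q : {q : E3 // q ∈ Y ∧ q ≠ p}) (w : E3), w ∈ ball p (δ / 2) →
      HasFDerivAt (fun w : E3 => lennardJones (dist w q.1))
        ((deriv lennardJones (dist w q.1) / dist w q.1) • innerSL ℝ (w - q.1)) w := by
    intro q w hw
    have hd0 := (abs_deriv_le_derivBound (hfar q) (mem_ball.1 hw)).1
    have hwq : w ≠ q.1 := dist_pos.1 hd0
    have h := hasFDerivAt_comp_dist_left hwq (hasDerivAt_lennardJones hd0.ne')
    rwa [← deriv_lennardJones hd0.ne'] at h
  have hf' : ∀ (q : {q : E3 // q ∈ Y ∧ q ≠ p}) (w : E3), w ∈ ball p (δ / 2) →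
      ‖(deriv lennardJones (dist w q.1) / dist w q.1) • innerSL ℝ (w - q.1)‖ ≤
        derivBound (dist p q.1) := by
    intro q w hw
    obtain ⟨hd0, hle⟩ := abs_deriv_le_derivBound (hfar q) (mem_ball.1 hw)
    rw [norm_force_functional hd0]
    exact hle
  have hp0 : p ∈ ball p (δ / 2) := mem_ball_self (half_pos hδ)
  have hf0 : Summable fun q : {q : E3 // q ∈ Y ∧ q ≠ p} => lennardJones (dist p q.1) :=
    summable_restrict (g := fun y => lennardJones (dist p y)) (hμ.summable p)
  -- the field is differentiable at `p`, with derivative the series of pair-force functionals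
  have hD : HasFDerivAt (fun w : E3 => ∑' q : {q : E3 // q ∈ Y ∧ q ≠ p}, lennardJones (dist w q.1))
      (∑' q : {q : E3 // q ∈ Y ∧ q ≠ p},
        (deriv lennardJones (dist p q.1) / dist p q.1) • innerSL ℝ (p - q.1)) p :=
    hasFDerivAt_tsum_of_isPreconnected hu isOpen_ball (convex_ball p (δ / 2)).isPreconnected hf hf'
      hp0 hf0 hp0
  -- Fermat
  have hzero := (isLocalMin_field hδ hsep hμ hp).hasFDerivAt_eq_zero hD
  -- the functional series sums to `0`
  have hFsum : Summable fun q : {q : E3 // q ∈ Y ∧ q ≠ p} =>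
      (deriv lennardJones (dist p q.1) / dist p q.1) • innerSL ℝ (p - q.1) :=
    hu.of_norm_bounded fun q => hf' q p hp0
  have hF : HasSum (fun q : {q : E3 // q ∈ Y ∧ q ≠ p} =>
      (deriv lennardJones (dist p q.1) / dist p q.1) • innerSL ℝ (p - q.1)) 0 := by
    rw [← hzero]; exact hFsum.hasSum
  -- the vector series is summable; test it against an arbitrary vector
  have hVsum : Summable fun q : {q : E3 // q ∈ Y ∧ q ≠ p} =>
      (deriv lennardJones (dist p q.1) / dist p q.1) • (p - q.1) := by
    refine hu.of_norm_bounded fun q => ?_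
    obtain ⟨hd0, hle⟩ := abs_deriv_le_derivBound (hfar q) hp0
    rw [norm_force_vector hd0]
    exact hle
  obtain ⟨S, hS⟩ := hVsum
  have hSz : ∀ z : E3, ⟪z, S⟫ = 0 := by
    intro z
    have h1 : HasSum (fun q : {q : E3 // q ∈ Y ∧ q ≠ p} =>
        ⟪z, (deriv lennardJones (dist p q.1) / dist p q.1) • (p - q.1)⟫) ⟪z, S⟫ := by
      simpa only [innerSL_apply_apply] using hS.mapL (innerSL ℝ z)
    have h2 : HasSum (fun q : {q : E3 // q ∈ Y ∧ q ≠ p} =>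
        ⟪z, (deriv lennardJones (dist p q.1) / dist p q.1) • (p - q.1)⟫) 0 := by
      have h := hF.mapL (ContinuousLinearMap.apply ℝ ℝ z)
      simp only [ContinuousLinearMap.apply_apply, smul_apply, innerSL_apply_apply, smul_eq_mul,
        map_zero] at h
      simpa only [real_inner_smul_right, real_inner_comm] using h
    exact h1.unique h2
  have hS0 : S = 0 := inner_self_eq_zero.1 (hSz S)
  rwa [hS0] at hS

/-- The piece restated with the binders of `MuGSCForceBalance` opened. [folklore] -/
theorem equil_of_isMuGSC {e : ℝ} {Y : Set E3} (hUD : UniformlyDiscrete Y)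
    (hμ : IsMuGSC lennardJones e Y) : Equil Y :=
  muGSCForceBalance e Y hUD hμ

/-- **Half B from THREE open pieces.** With `MuGSCForceBalance` proved, door half B of the skeleton
«HostedDustCut» (the registered text of `stub_corefreeRigidity`) follows from `CorefreeChart`,
`LargeScaleRegularity`, `StackingSelection` and the two `ExcessDecayLiouville` items. -/
theorem corefreeRigidity_of_three_pieces (hC : CorefreeChart) (hL : LargeScaleRegularity)
    (hS : StackingSelection)
    (h9332 : Summit.AtomisticToContinuum.Crystallization.Theses.ExcessDecayLiouville.HcpLiouville)
    (h9333 : Summit.AtomisticToContinuum.Crystallization.Theses.ExcessDecayLiouville.PhononStability) :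
    ∀ e : ℝ, Filter.Tendsto (fun N : ℕ => Literature.MathematicalPhysics.StatisticalMechanics.groundStateEnergy Literature.MathematicalPhysics.StatisticalMechanics.lennardJones 3 N / N) Filter.atTop (nhds e) → (∀ N : ℕ, 0 < N → e ≤ Literature.MathematicalPhysics.StatisticalMechanics.groundStateEnergy Literature.MathematicalPhysics.StatisticalMechanics.lennardJones 3 N / N) → ∀ Y : Set (EuclideanSpace ℝ (Fin 3)), Literature.MathematicalPhysics.StatisticalMechanics.UniformlyDiscrete Y → Literature.MathematicalPhysics.StatisticalMechanics.IsMuGSC Literature.MathematicalPhysics.StatisticalMechanics.lennardJones e Y → (∀ z : EuclideanSpace ℝ (Fin 3), ∃ w ∈ Y, dist z w < 9 / 10) → ∀ a : ℝ, 47 / 50 ≤ a → a ≤ 1 → ∀ D : ℝ, 0 ≤ D → D ≤ 13 → (∀ p ∈ Y, ∀ q ∈ Y, ¬ ({w ∈ Y | w ≠ p ∧ dist p w ≤ a * (1 + 1 / 50)}.ncard = 12 ∧ ∀ w ∈ Y, w ≠ p → a * (1 - 1 / 50) ≤ dist p w ∧ (dist p w ≤ a * (1 + 1 / 50) ∨ a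 * (63 / 50) ≤ dist p w)) → ¬ ({w ∈ Y | w ≠ q ∧ dist q w ≤ a * (1 + 1 / 50)}.ncard = 12 ∧ ∀ w ∈ Y, w ≠ q → a * (1 - 1 / 50) ≤ dist q w ∧ (dist q w ≤ a * (1 + 1 / 50) ∨ a * (63 / 50) ≤ dist q w)) → (dist p q ≤ D ∨ 2 * D + 6 ≤ dist p q)) → (∀ y ∈ Y, ({w ∈ Y | w ≠ y ∧ dist y w ≤ a * (1 + 1 / 50)}.ncard = 12 ∧ ∀ w ∈ Y, w ≠ y → a * (1 - 1 / 50) ≤ dist y w ∧ (dist y w ≤ a * (1 + 1 / 50) ∨ a * (63 / 50) ≤ dist y w)) → (∃ T : Finset (EuclideanSpace ℝ (Fin 3)), (↑T : Set (EuclideanSpace ℝ (Fin 3))) = (fun w => a⁻¹ • (w - y)) '' {w ∈ Y | w ≠ y ∧ dist y w ≤ a * (1 + 1 / 50)} ∧ (Literature.Geometry.DiscreteGeometry.ShellCloseTo (1 / 5) T Literature.Geometry.DiscreteGeometry.fccKissingPattern ∨ Literature.Geometry.DiscreteGeometry.ShellCloseTo (1 / 5) T Literature.Geometry.DiscreteGeometry.hcpKissingPattern)))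 → (∀ y ∈ Y, ¬ ¬ (({v ∈ Y | v ≠ y ∧ dist y v ≤ a * (1 + 1 / 10)}.ncard = 12 ∧ ∀ v ∈ Y, v ≠ y → a * (1 - 1 / 10) ≤ dist y v ∧ (dist y v ≤ a * (1 + 1 / 10) ∨ a * (63 / 50) ≤ dist y v)) ∧ (∃ T : Finset (EuclideanSpace ℝ (Fin 3)), (↑T : Set (EuclideanSpace ℝ (Fin 3))) = (fun v => a⁻¹ • (v - y)) '' {v ∈ Y | v ≠ y ∧ dist y v ≤ a * (1 + 1 / 10)} ∧ (Literature.Geometry.DiscreteGeometry.ShellCloseTo (2 / 5) T Literature.Geometry.DiscreteGeometry.fccKissingPattern ∨ Literature.Geometry.DiscreteGeometry.ShellCloseTo (2 / 5) T Literature.Geometry.DiscreteGeometry.hcpKissingPattern)))) → ∀ y ∈ Y, ({w ∈ Y | w ≠ y ∧ dist y w ≤ a * (1 + 1 / 50)}.ncard = 12 ∧ ∀ w ∈ Y, w ≠ y → a * (1 - 1 / 50) ≤ dist y w ∧ (dist y w ≤ a * (1 + 1 / 50) ∨ a * (63 / 50) ≤ dist y w)) :=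
  stub_corefreeRigidity_of_pieces hC muGSCForceBalance hL hS h9332 h9333

end Summit.AtomisticToContinuum.Crystallization.Theorems.OverbindingBudgetCorefreeBridge

end
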